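import Literature.AlgebraicGeometry.HodgeTheory.ComplexTorusIntegralHodgeClassesMultiplicationCorrespondences
import Literature.AlgebraicGeometry.HodgeTheory.ComplexTorusIntegralHodgeClassesCorrespondenceComposition
import HarnessLib

/-!
# Multiplication correspondences and graphs: `Γ_f ∘ Δ_*(u) = (1, f)_*(u)`, `Δ_*(v) ∘ Γ_f = Γ_f ∘ Δ_*(f^*v)`, `Γ_f ∘ Δ_*(u) ∘ ᵗΓ_f = Δ_*(f_*u)`

Sequel of g33-#3 `ComplexTorusIntegralHodgeClassesMultiplicationCorrespondences` (`Δ_*(v) ∘ α = α · p₂^*v`, `β ∘ Δ_*(v) = p₁^*v · β` for every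
correspondence) and of g27/g28 `ComplexTorusIntegralHodgeClassesCorrespondenceComposition` (Fulton's Prop. 16.1.1 (c)(i) `Γ_g ∘ α = (1_X × g)_*α` on
the integral carriers). For a morphism of complex tori `f : X ⟶ Y`, `u ∈ Hdgᶜ(X, ℤ)`, `v ∈ Hdgᶜ(Y, ℤ)`, with the graph class `[Γ_f] = (1_X, f)_*(1_X) ∈
Hdg^{g_Y}(X × Y, ℤ)`, its transpose `[Γ_f]′ = (f, 1_X)_*(1_X) ∈ Hdg^{g_Y}(Y × X, ℤ)` (g27-#6) and the multiplication correspondences `Δ_*(u) ∈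
Hdg^{c+g_X}(X × X, ℤ)`, `Δ_*(v) ∈ Hdg^{c+g_Y}(Y × Y, ℤ)` (composites `β ∘ α = p₁₃_*(p₁₂^*α · p₂₃^*β)` on the triple products, g27's convention), this file proves:

* §0 `Δ_X ≫ (1_X × f) = (1_X, f)` and `(f, 1_X) ≫ (1_Y × f) = f ≫ Δ_Y` [cite: Fulton1998, §16.1 Prop. 16.1.1 (c) proof (p0294 L26–L28; p0295 L1–L5)]
  [cite: Lange2023AbelianVarietiesComplex, §6.2.2 (p0304 L28)];
* §1 **`Γ_f ∘ Δ_*(u) = (1_X, f)_*(u)`** — the class of the graph "weighted by `u`" (Prop. 16.1.1 (c)(i) at `α = Δ_*(u)`: `(1_X × f)_*Δ_*(u) =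
  (Δ ≫ (1 × f))_*u`) [cite: Fulton1998, §16.1 Prop. 16.1.1 (c)(i) (p0293 L24) and §1.4 (p0023 L1: "(gf)_* = g_* f_*")];
* §2 **`Δ_*(v) ∘ Γ_f = (1_X, f)_*(f^*v)`** (g33-#3 §3 and Fulton's "`i_*(p^*a) = T · (a × Y)`" for `T = Γ_f`, `i = (1, f)`, `p = q = f ∘ pr`:
  `[Γ_f] · p₂^*v = (1, f)_*(((1, f) ≫ p₂)^*v) = (1, f)_*(f^*v)`) [cite: Fulton1998, §16.1 Example 16.1.14 (ii) (p0302 L14–L20) and Prop. 8.3 (c) (p0132 L46–L48)],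
  hence **`Δ_*(v) ∘ Γ_f = Γ_f ∘ Δ_*(f^*v)`**: on the action side this is the multiplicativity `f^*(v · b) = f^*v · f^*b` read through
  `(Γ_f)^* = f^*` [cite: Fulton1998, §16.1 Prop. 16.1.2 (c) (p0295 L25–L27) and Prop. 8.3 (a)–(b) (p0132 L40–L45)]
  [cite: Lange2023AbelianVarietiesComplex, §6.2.2 Prop. 6.2.9 (b) (p0304 L22: "ᵗΓ_f(β) = f^*(β)")];
* §3 the transposed forms **`Δ_*(u) ∘ ᵗΓ_f = (f, 1_X)_*(u)`**, **`ᵗΓ_f ∘ Δ_*(v) = (f, 1_X)_*(f^*v) = Δ_*(f^*v) ∘ ᵗΓ_f`** (same proofs with the transposed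
  graph morphism `(f, 1_X) : X → Y × X`, `(f, 1) ≫ p₁ = f`, `(f, 1) ≫ p₂ = 1_X`)
  [cite: Fulton1998, §16.1 Prop. 16.1.1 (b)–(c) (p0293 L22–L25) and Example 16.1.14 (ii) (p0302 L14–L20)];
* §4 **`Γ_f ∘ (f, 1_X)_*(u) = Δ_*(f_*u)`** and so **`Γ_f ∘ Δ_*(u) ∘ ᵗΓ_f = Δ_*(f_*u)`** — THE PROJECTION FORMULA `f_*(u · f^*b) = f_*u · b` AS AN IDENTITY OF
  CORRESPONDENCES (`(Γ_f)_* = f_*`, `(ᵗΓ_f)_* = f^*`, `(Δ_*u)_* = u · (−)`, g27-#4/#6 and g33-#3 §2); equivalently `(f × f)_*Δ_*(u) = Δ_*(f_*u)` (`(f × f)_*α = Γ_f ∘ α ∘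
  ᵗΓ_f`, Lieberman's lemma, g33-#2) since `Δ_X ≫ (f × f) = f ≫ Δ_Y` [cite: Fulton1998, Prop. 8.3 (c) (p0132 L46–L48), §16.1 Prop. 16.1.1 (c)(i) (p0293 L24) and
  Example 16.1.14 (ii) (p0302 L14–L20)] [cite: HuTruong2021, Lemma 2.12] [cite: Lange2023AbelianVarietiesComplex, §6.2.1 Thm. 6.2.4 (p0302 L17–L19)].

Everything is a theorem (no definition, no named fact, D-0026); frames are arbitrary and explicit as in g27–g33; `X × Y` is `prodObj X Y`; a name
`integralHodgeClassesCorrComp_A_B` lists the class in the `p₁₂`-slot (`A`) before the class in the `p₂₃`-slot (`B`), i.e. it computes `B ∘ A`.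

## References

* [Fulton1998] W. Fulton, Intersection Theory, 2nd ed., Springer 1998 — §16.1 Prop. 16.1.1, Prop. 16.1.2, Example 16.1.14 (PDF p0293–p0302); Prop. 8.3 (p0132); §1.4 (p0023).
* [Lange2023AbelianVarietiesComplex] H. Lange, Abelian Varieties over the Complex Numbers, Springer 2023 — §6.2.1 Thm. 6.2.4, §6.2.2 Prop. 6.2.9.
* [HuTruong2021] F. Hu, T. T. Truong, A dynamical approach to generalized Weil's Riemann hypothesis and semisimplicity, arXiv:2102.04405 — Lemma 2.12 (Lieberman's lemma).
-/

noncomputable section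

open CategoryTheory Function

namespace Literature.AlgebraicGeometry.HodgeTheory

open Literature.AlgebraicGeometry.Motives Literature.AlgebraicGeometry.Motives.HodgeStructure
open Literature.Geometry.Kaehler Literature.Geometry.Kaehler.ComplexTorus

namespace ComplexTorusCat

/-! ## §0 `Δ_X ≫ (1_X × f) = (1_X, f)` and `(f, 1_X) ≫ (1_Y × f) = f ≫ Δ_Y` -/

section Plumbing

variable {X Y : ComplexTorusCat} (f : X ⟶ Y)

/-- `Δ_X ≫ (1_X × f) = (1_X, f) = γ_f`, the graph morphism. [cite: Fulton1998, §16.1 Prop. 16.1.1 (c) proof (p0294 L26–L28: "p_{XZ}(1_X × γ_g) = 1_X × g")] -/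
theorem diagHom_comp_prodMap_id_eq_graphHom : diagHom X ≫ prodMap (𝟙 X) f = graphHom f := by
  rw [graphHom_def]
  refine prod_hom_ext ?_ ?_ <;> simp

/-- `(f, 1_X) ≫ (1_Y × f) = (f, f) = f ≫ Δ_Y`. [cite: Lange2023AbelianVarietiesComplex, §6.2.2 (p0304 L28)] [cite: Fulton1998, §16.1 Prop. 16.1.1 (c) proof (p0295 L1–L5)] -/
theorem liftHom_id_comp_prodMap_id : liftHom f (𝟙 X) ≫ prodMap (𝟙 Y) f = f ≫ diagHom Y := by
  refine prod_hom_ext ?_ ?_ <;> simp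

end Plumbing

/-! ## §1 `Γ_f ∘ Δ_*(u) = (1_X, f)_*(u)` -/

section GraphAfter

variable {X Y : ComplexTorusCat} {gX gY gXX gXY gT₁ : ℕ} (f : X ⟶ Y) (eX : Fin (2 * gX) ≃ X.toIsog.ι) (eY : Fin (2 * gY) ≃ Y.toIsog.ι)
  (eXX : Fin (2 * gXX) ≃ (prodObj X X).toIsog.ι) (eXY : Fin (2 * gXY) ≃ (prodObj X Y).toIsog.ι) (eT₁ : Fin (2 * gT₁) ≃ (prodObj X (prodObj X Y)).toIsog.ι)
  (hX : 2 * gX + 2 * 0 = 2 * gX) (hgX : gX + gX = 2 * gX) (hXY : 2 * gX + 2 * gY = 2 * gXY) (hgXY : gXY + gXY = 2 * gXY)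
  (hXX0 : 2 * gXX + 2 * 0 = 2 * gXX) (hgXX : gXX + gXX = 2 * gXX) (hT₁ : 2 * gXX + 2 * gY = 2 * gT₁) (hgT₁ : gT₁ + gT₁ = 2 * gT₁) (hgg₁ : gXX + gY = gT₁)
  {c c' K ac l : ℕ} (hK : c' + gY = K) (hl : l + 2 * c = 2 * gX) (hl' : l + 2 * c' = 2 * gXX) (h3 : l + 2 * K = 2 * gT₁) (hb : l + 2 * ac = 2 * gXY)

include eY hXX0 hT₁ hgg₁ in
/-- **`Γ_f ∘ Δ_*(u) = (1_X, f)_*(u)`** for `f : X ⟶ Y` and `u ∈ Hdgᶜ(X, ℤ)`: `p₁₃_*(p₁₂^*(Δ_*u) · p₂₃^*[Γ_f]) = (1_X, f)_*(u)` in `Hdg^{c+g_Y}(X × Y, ℤ)` (composite on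
`X × (X × Y)`) — Fulton's Prop. 16.1.1 (c)(i) `Γ_f ∘ α = (1_X × f)_*α` (g27 `integralHodgeClassesCorrComp_graphClass_right`) at `α = Δ_*(u)`, then
`(1_X × f)_*Δ_* = (Δ ≫ (1_X × f))_* = (1_X, f)_*`. [cite: Fulton1998, §16.1 Prop. 16.1.1 (c)(i) with proof (p0293 L24; p0294 L21–L28) and §1.4 (p0023 L1)]
[cite: Lange2023AbelianVarietiesComplex, §6.2.2 (p0303 L40–L42)] -/
theorem integralHodgeClassesCorrComp_pushforward_diagHom_graphClass (u : integralHodgeClasses X.toIsog.Φ c) :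
    integralHodgeClassesPushforward K ac (liftHom (fstHom X (prodObj X Y)) (sndHom X (prodObj X Y) ≫ sndHom X Y)) eT₁ eXY h3 hgT₁ hb hgXY
      (integralHodgeClassesCup (prodObj X (prodObj X Y)).toIsog.Φ hK
        (integralHodgeClassesPullbackHom (liftHom (fstHom X (prodObj X Y)) (sndHom X (prodObj X Y) ≫ fstHom X Y)) c'
          (integralHodgeClassesPushforward c c' (diagHom X) eX eXX hl hgX hl' hgXX u))
        (integralHodgeClassesPullbackHom (sndHom X (prodObj X Y)) gY
          (integralHodgeClassesPushforward 0 gY (graphHom f) eX eXY hX hgX hXY hgXY (unitIntegralHodgeClass X)))) =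
      integralHodgeClassesPushforward c ac (graphHom f) eX eXY hl hgX hb hgXY u := by
  rw [integralHodgeClassesCorrComp_graphClass_right hgg₁ f eX eY eXX eXY eXY eT₁ hX hgX hXY hgXY hXX0 hgXX hT₁ hgT₁ hgXY hK hl' h3 hb
      (integralHodgeClassesPushforward c c' (diagHom X) eX eXX hl hgX hl' hgXX u),
    ← integralHodgeClassesPushforward_comp, diagHom_comp_prodMap_id_eq_graphHom]

end GraphAfter

/-! ## §2 `Δ_*(v) ∘ Γ_f = (1_X, f)_*(f^*v) = Γ_f ∘ Δ_*(f^*v)` -/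

section GraphBefore

variable {X Y : ComplexTorusCat} {gX gY gXY gYY gT₂ : ℕ} (f : X ⟶ Y) (eX : Fin (2 * gX) ≃ X.toIsog.ι) (eY : Fin (2 * gY) ≃ Y.toIsog.ι)
  (eXY : Fin (2 * gXY) ≃ (prodObj X Y).toIsog.ι) (eYY : Fin (2 * gYY) ≃ (prodObj Y Y).toIsog.ι) (eT₂ : Fin (2 * gT₂) ≃ (prodObj X (prodObj Y Y)).toIsog.ι)
  (hX : 2 * gX + 2 * 0 = 2 * gX) (hgX : gX + gX = 2 * gX) (hXY : 2 * gX + 2 * gY = 2 * gXY) (hgXY : gXY + gXY = 2 * gXY) (hgY : gY + gY = 2 * gY)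
  (hgYY : gYY + gYY = 2 * gYY) (hgT₂ : gT₂ + gT₂ = 2 * gT₂) (hN₂ : 2 * gX + 2 * gYY = 2 * gT₂)
  {c cY ac K₂ m l l₂ : ℕ} (hac : gY + c = ac) (hK₂ : gY + cY = K₂) (hm : m + 2 * c = 2 * gY) (hm' : m + 2 * cY = 2 * gYY) (h3₂ : l₂ + 2 * K₂ = 2 * gT₂)
  (h3₂' : l₂ + 2 * ac = 2 * gXY) (hl : l + 2 * c = 2 * gX) (hb : l + 2 * ac = 2 * gXY)

include hN₂ hac in
/-- **`Δ_*(v) ∘ Γ_f = (1_X, f)_*(f^*v)`** for `f : X ⟶ Y` and `v ∈ Hdgᶜ(Y, ℤ)`: `p₁₃_*(p₁₂^*[Γ_f] · p₂₃^*(Δ_*v)) = (1_X, f)_*(f^*v)` in `Hdg^{c+g_Y}(X × Y, ℤ)`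
(composite on `X × (Y × Y)`): `Δ_*(v) ∘ [Γ_f] = [Γ_f] · p₂^*v` (g33-#3 §3) and Fulton's "`i_*(p^*a) = T · (a × Y)`" for `T = Γ_f`, `i = (1_X, f)`:
`[Γ_f] · p₂^*v = (1, f)_*(((1, f) ≫ p₂)^*v) = (1, f)_*(f^*v)` (g28-#10 `integralHodgeClassesPushforward_pullbackHom_comp_sndHom`).
[cite: Fulton1998, §16.1 Example 16.1.14 (ii) (p0302 L14–L20) and Prop. 8.3 (c) (p0132 L46–L48)] [cite: Lange2023AbelianVarietiesComplex, §6.2.1 Thm. 6.2.4 (p0302 L17–L19)] -/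
theorem integralHodgeClassesCorrComp_graphClass_pushforward_diagHom (v : integralHodgeClasses Y.toIsog.Φ c) :
    integralHodgeClassesPushforward K₂ ac (liftHom (fstHom X (prodObj Y Y)) (sndHom X (prodObj Y Y) ≫ sndHom Y Y)) eT₂ eXY h3₂ hgT₂ h3₂' hgXY
      (integralHodgeClassesCup (prodObj X (prodObj Y Y)).toIsog.Φ hK₂
        (integralHodgeClassesPullbackHom (liftHom (fstHom X (prodObj Y Y)) (sndHom X (prodObj Y Y) ≫ fstHom Y Y)) gY
          (integralHodgeClassesPushforward 0 gY (graphHom f) eX eXY hX hgX hXY hgXY (unitIntegralHodgeClass X)))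
        (integralHodgeClassesPullbackHom (sndHom X (prodObj Y Y)) cY (integralHodgeClassesPushforward c cY (diagHom Y) eY eYY hm hgY hm' hgYY v))) =
      integralHodgeClassesPushforward c ac (graphHom f) eX eXY hl hgX hb hgXY (integralHodgeClassesPullbackHom f c v) := by
  rw [integralHodgeClassesCorrComp_pushforward_diagHom_right eX eY eXY eYY eT₂ hXY hN₂ hgY hgXY hgYY hgT₂ hac hK₂ hm hm' h3₂ h3₂'
      (integralHodgeClassesPushforward 0 gY (graphHom f) eX eXY hX hgX hXY hgXY (unitIntegralHodgeClass X)) v,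
    ← integralHodgeClassesPushforward_pullbackHom_comp_sndHom (graphHom f) eX eXY hgX hgXY hX hXY hac hl hb v, graphHom_sndHom]

variable {gXX gT₁ : ℕ} (eXX : Fin (2 * gXX) ≃ (prodObj X X).toIsog.ι) (eT₁ : Fin (2 * gT₁) ≃ (prodObj X (prodObj X Y)).toIsog.ι) (hXX0 : 2 * gXX + 2 * 0 = 2 * gXX)
  (hgXX : gXX + gXX = 2 * gXX) (hT₁ : 2 * gXX + 2 * gY = 2 * gT₁) (hgT₁ : gT₁ + gT₁ = 2 * gT₁) (hgg₁ : gXX + gY = gT₁) {c' K : ℕ} (hK : c' + gY = K)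
  (hl' : l + 2 * c' = 2 * gXX) (h3 : l + 2 * K = 2 * gT₁)

include hN₂ hac hXX0 hT₁ hgg₁ in
/-- **`Δ_*(v) ∘ Γ_f = Γ_f ∘ Δ_*(f^*v)`** for `f : X ⟶ Y`, `v ∈ Hdgᶜ(Y, ℤ)` — both composites (on `X × (Y × Y)`, resp. `X × (X × Y)`) are
`(1_X, f)_*(f^*v) ∈ Hdg^{c+g_Y}(X × Y, ℤ)` (§2, §1). On the action side (`(Γ_f)^* = f^*`, `(Δ_*v)^* = v · (−)`, `(β ∘ α)^* = α^* ∘ β^*`) this is `f^*(v · b) = f^*v · f^*b`; on the motivic side it says that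
`f^* : h(Y) → h(X)` intertwines the Lefschetz-type operators `L_v` and `L_{f^*v}`. [cite: Fulton1998, §16.1 Prop. 16.1.1 (c) (p0293 L24–L25), Prop. 16.1.2 (a), (c) (p0295 L19–L27)
and Prop. 8.3 (b)–(c) (p0132 L42–L48)] [cite: Lange2023AbelianVarietiesComplex, §6.2.2 Prop. 6.2.9 (b) (p0304 L22: "ᵗΓ_f(β) = f^*(β)")] -/
theorem integralHodgeClassesCorrComp_graphClass_pushforward_diagHom_comm (v : integralHodgeClasses Y.toIsog.Φ c) :
    integralHodgeClassesPushforward K₂ ac (liftHom (fstHom X (prodObj Y Y)) (sndHom X (prodObj Y Y) ≫ sndHom Y Y)) eT₂ eXY h3₂ hgT₂ h3₂' hgXY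
      (integralHodgeClassesCup (prodObj X (prodObj Y Y)).toIsog.Φ hK₂
        (integralHodgeClassesPullbackHom (liftHom (fstHom X (prodObj Y Y)) (sndHom X (prodObj Y Y) ≫ fstHom Y Y)) gY
          (integralHodgeClassesPushforward 0 gY (graphHom f) eX eXY hX hgX hXY hgXY (unitIntegralHodgeClass X)))
        (integralHodgeClassesPullbackHom (sndHom X (prodObj Y Y)) cY (integralHodgeClassesPushforward c cY (diagHom Y) eY eYY hm hgY hm' hgYY v))) =
      integralHodgeClassesPushforward K ac (liftHom (fstHom X (prodObj X Y)) (sndHom X (prodObj X Y) ≫ sndHom X Y)) eT₁ eXY h3 hgT₁ hb hgXY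
      (integralHodgeClassesCup (prodObj X (prodObj X Y)).toIsog.Φ hK
        (integralHodgeClassesPullbackHom (liftHom (fstHom X (prodObj X Y)) (sndHom X (prodObj X Y) ≫ fstHom X Y)) c'
          (integralHodgeClassesPushforward c c' (diagHom X) eX eXX hl hgX hl' hgXX (integralHodgeClassesPullbackHom f c v)))
        (integralHodgeClassesPullbackHom (sndHom X (prodObj X Y)) gY
          (integralHodgeClassesPushforward 0 gY (graphHom f) eX eXY hX hgX hXY hgXY (unitIntegralHodgeClass X)))) := by
  rw [integralHodgeClassesCorrComp_graphClass_pushforward_diagHom f eX eY eXY eYY eT₂ hX hgX hXY hgXY hgY hgYY hgT₂ hN₂ hac hK₂ hm hm' h3₂ h3₂' hl hb,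
    integralHodgeClassesCorrComp_pushforward_diagHom_graphClass f eX eY eXX eXY eT₁ hX hgX hXY hgXY hXX0 hgXX hT₁ hgT₁ hgg₁ hK hl hl' h3 hb]

end GraphBefore

/-! ## §3 The transposed graph: `Δ_*(u) ∘ ᵗΓ_f = (f, 1_X)_*(u)`, `ᵗΓ_f ∘ Δ_*(v) = (f, 1_X)_*(f^*v) = Δ_*(f^*v) ∘ ᵗΓ_f` -/

section TransposeGraph

variable {X Y : ComplexTorusCat} {gX gY gXX gYX gT₃ : ℕ} (f : X ⟶ Y) (eX : Fin (2 * gX) ≃ X.toIsog.ι) (eY : Fin (2 * gY) ≃ Y.toIsog.ι)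
  (eXX : Fin (2 * gXX) ≃ (prodObj X X).toIsog.ι) (eYX : Fin (2 * gYX) ≃ (prodObj Y X).toIsog.ι) (eT₃ : Fin (2 * gT₃) ≃ (prodObj Y (prodObj X X)).toIsog.ι)
  (hX : 2 * gX + 2 * 0 = 2 * gX) (hgX : gX + gX = 2 * gX) (hYX : 2 * gX + 2 * gY = 2 * gYX) (hgYX : gYX + gYX = 2 * gYX) (hgXX : gXX + gXX = 2 * gXX)
  (hgT₃ : gT₃ + gT₃ = 2 * gT₃) (hN₃ : 2 * gY + 2 * gX = 2 * gYX) (hN₃' : 2 * gY + 2 * gXX = 2 * gT₃)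
  {c c' ac K l l₃ : ℕ} (hac : gY + c = ac) (hK' : gY + c' = K) (hl : l + 2 * c = 2 * gX) (hl' : l + 2 * c' = 2 * gXX) (h3₃ : l₃ + 2 * K = 2 * gT₃)
  (h3₃' : l₃ + 2 * ac = 2 * gYX) (hk₂ : l + 2 * ac = 2 * gYX)

include eY hN₃ hN₃' hac in
/-- **`Δ_*(u) ∘ ᵗΓ_f = (f, 1_X)_*(u)`** for `f : X ⟶ Y` and `u ∈ Hdgᶜ(X, ℤ)`: `p₁₃_*(p₁₂^*[Γ_f]′ · p₂₃^*(Δ_*u)) = (f, 1_X)_*(u)` in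
`Hdg^{c+g_Y}(Y × X, ℤ)` (composite on `Y × (X × X)`; `[Γ_f]′ = (f, 1_X)_*(1_X)`, g27-#6): `Δ_*(u) ∘ [Γ_f]′ = [Γ_f]′ · p₂^*u = (f, 1)_*(((f, 1) ≫ p₂)^*u) = (f, 1)_*(u)` (g33-#3 §3, g28-#10, `(f, 1) ≫ p₂ = 1_X`).
[cite: Fulton1998, §16.1 Prop. 16.1.1 (b)–(c) (p0293 L22–L25) and Example 16.1.14 (ii) (p0302 L14–L20)] [cite: Lange2023AbelianVarietiesComplex, §6.2.2 Prop. 6.2.9 (b) (p0304 L22)] -/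
theorem integralHodgeClassesCorrComp_transposeGraphClass_pushforward_diagHom (u : integralHodgeClasses X.toIsog.Φ c) :
    integralHodgeClassesPushforward K ac (liftHom (fstHom Y (prodObj X X)) (sndHom Y (prodObj X X) ≫ sndHom X X)) eT₃ eYX h3₃ hgT₃ h3₃' hgYX
      (integralHodgeClassesCup (prodObj Y (prodObj X X)).toIsog.Φ hK'
        (integralHodgeClassesPullbackHom (liftHom (fstHom Y (prodObj X X)) (sndHom Y (prodObj X X) ≫ fstHom X X)) gY
          (integralHodgeClassesPushforward 0 gY (liftHom f (𝟙 X)) eX eYX hX hgX hYX hgYX (unitIntegralHodgeClass X)))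
        (integralHodgeClassesPullbackHom (sndHom Y (prodObj X X)) c' (integralHodgeClassesPushforward c c' (diagHom X) eX eXX hl hgX hl' hgXX u))) =
      integralHodgeClassesPushforward c ac (liftHom f (𝟙 X)) eX eYX hl hgX hk₂ hgYX u := by
  rw [integralHodgeClassesCorrComp_pushforward_diagHom_right eY eX eYX eXX eT₃ hN₃ hN₃' hgX hgYX hgXX hgT₃ hac hK' hl hl' h3₃ h3₃'
      (integralHodgeClassesPushforward 0 gY (liftHom f (𝟙 X)) eX eYX hX hgX hYX hgYX (unitIntegralHodgeClass X)) u,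
    ← integralHodgeClassesPushforward_pullbackHom_comp_sndHom (liftHom f (𝟙 X)) eX eYX hgX hgYX hX hYX hac hl hk₂ u, liftHom_sndHom,
    integralHodgeClassesPullbackHom_id]

variable {gYY gT₄ : ℕ} (eYY : Fin (2 * gYY) ≃ (prodObj Y Y).toIsog.ι) (eT₄ : Fin (2 * gT₄) ≃ (prodObj Y (prodObj Y X)).toIsog.ι)
  (eA₄ : Fin (2 * gT₄) ≃ (prodObj (prodObj Y Y) X).toIsog.ι) (hgY : gY + gY = 2 * gY) (hgYY : gYY + gYY = 2 * gYY) (hgT₄ : gT₄ + gT₄ = 2 * gT₄)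
  (hM₄' : 2 * gYY + 2 * gX = 2 * gT₄) {cY K₂ m l₄ : ℕ} (hca : c + gY = ac) (hK₂' : cY + gY = K₂) (hm : m + 2 * c = 2 * gY) (hm' : m + 2 * cY = 2 * gYY)
  (h3₄ : l₄ + 2 * K₂ = 2 * gT₄) (h3₄' : l₄ + 2 * ac = 2 * gYX)

include eA₄ hN₃ hM₄' hac hca in
/-- **`ᵗΓ_f ∘ Δ_*(v) = (f, 1_X)_*(f^*v)`** for `f : X ⟶ Y` and `v ∈ Hdgᶜ(Y, ℤ)`: `p₁₃_*(p₁₂^*(Δ_*v) · p₂₃^*[Γ_f]′) = (f, 1_X)_*(f^*v)` in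
`Hdg^{c+g_Y}(Y × X, ℤ)` (composite on `Y × (Y × X)`): `[Γ_f]′ ∘ Δ_*(v) = p₁^*v · [Γ_f]′` (g33-#3 §3′) `= (f, 1)_*(((f, 1) ≫ p₁)^*v) = (f, 1)_*(f^*v)` (g28-#10 `integralHodgeClassesPushforward_pullbackHom_comp_fstHom`,
`(f, 1) ≫ p₁ = f`) — Lange's "`ᵗΓ_f(β) = f^*(β)`" weighted by `v`. [cite: Fulton1998, §16.1 Prop. 16.1.1 (b)–(c) (p0293 L22–L25) and Example 16.1.14 (ii) (p0302 L14–L20)]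
[cite: Lange2023AbelianVarietiesComplex, §6.2.2 Prop. 6.2.9 (b) (p0304 L22: "ᵗΓ_f(β) = f^*(β)")] -/
theorem integralHodgeClassesCorrComp_pushforward_diagHom_transposeGraphClass (v : integralHodgeClasses Y.toIsog.Φ c) :
    integralHodgeClassesPushforward K₂ ac (liftHom (fstHom Y (prodObj Y X)) (sndHom Y (prodObj Y X) ≫ sndHom Y X)) eT₄ eYX h3₄ hgT₄ h3₄' hgYX
      (integralHodgeClassesCup (prodObj Y (prodObj Y X)).toIsog.Φ hK₂'
        (integralHodgeClassesPullbackHom (liftHom (fstHom Y (prodObj Y X)) (sndHom Y (prodObj Y X) ≫ fstHom Y X)) cY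
          (integralHodgeClassesPushforward c cY (diagHom Y) eY eYY hm hgY hm' hgYY v))
        (integralHodgeClassesPullbackHom (sndHom Y (prodObj Y X)) gY
          (integralHodgeClassesPushforward 0 gY (liftHom f (𝟙 X)) eX eYX hX hgX hYX hgYX (unitIntegralHodgeClass X)))) =
      integralHodgeClassesPushforward c ac (liftHom f (𝟙 X)) eX eYX hl hgX hk₂ hgYX (integralHodgeClassesPullbackHom f c v) := by
  rw [integralHodgeClassesCorrComp_pushforward_diagHom_left eY eYY eX eYX eT₄ eA₄ hN₃ hM₄' hgY hgYY hgYX hgT₄ hca hK₂' hm hm' h3₄ h3₄' v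
      (integralHodgeClassesPushforward 0 gY (liftHom f (𝟙 X)) eX eYX hX hgX hYX hgYX (unitIntegralHodgeClass X)),
    integralHodgeClassesCup_comm (prodObj Y X).toIsog.Φ hac hca,
    ← integralHodgeClassesPushforward_pullbackHom_comp_fstHom (liftHom f (𝟙 X)) eX eYX hgX hgYX hX hYX hac hl hk₂ v, liftHom_fstHom]

include eA₄ hN₃ hN₃' hM₄' hac hca hk₂ in
/-- **`ᵗΓ_f ∘ Δ_*(v) = Δ_*(f^*v) ∘ ᵗΓ_f`** for `f : X ⟶ Y`, `v ∈ Hdgᶜ(Y, ℤ)` — both composites (on `Y × (Y × X)`, resp. `Y × (X × X)`) are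
`(f, 1_X)_*(f^*v) ∈ Hdg^{c+g_Y}(Y × X, ℤ)`; the transpose of §2 (`(β ∘ α)′ = α′ ∘ β′`, `Δ_*(w)′ = Δ_*(w)`). On the action side (`(ᵗΓ_f)_* = f^*`) this is again `f^*(v · b) = f^*v · f^*b`.
[cite: Fulton1998, §16.1 Prop. 16.1.1 (b)–(c) (p0293 L22–L25), Prop. 16.1.2 (b)–(c) (p0295 L23–L27) and Prop. 8.3 (b)–(c) (p0132 L42–L48)]
[cite: Lange2023AbelianVarietiesComplex, §6.2.2 Prop. 6.2.9 (b) (p0304 L22)] -/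
theorem integralHodgeClassesCorrComp_transposeGraphClass_pushforward_diagHom_comm (v : integralHodgeClasses Y.toIsog.Φ c) :
    integralHodgeClassesPushforward K₂ ac (liftHom (fstHom Y (prodObj Y X)) (sndHom Y (prodObj Y X) ≫ sndHom Y X)) eT₄ eYX h3₄ hgT₄ h3₄' hgYX
      (integralHodgeClassesCup (prodObj Y (prodObj Y X)).toIsog.Φ hK₂'
        (integralHodgeClassesPullbackHom (liftHom (fstHom Y (prodObj Y X)) (sndHom Y (prodObj Y X) ≫ fstHom Y X)) cY
          (integralHodgeClassesPushforward c cY (diagHom Y) eY eYY hm hgY hm' hgYY v))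
        (integralHodgeClassesPullbackHom (sndHom Y (prodObj Y X)) gY
          (integralHodgeClassesPushforward 0 gY (liftHom f (𝟙 X)) eX eYX hX hgX hYX hgYX (unitIntegralHodgeClass X)))) =
      integralHodgeClassesPushforward K ac (liftHom (fstHom Y (prodObj X X)) (sndHom Y (prodObj X X) ≫ sndHom X X)) eT₃ eYX h3₃ hgT₃ h3₃' hgYX
      (integralHodgeClassesCup (prodObj Y (prodObj X X)).toIsog.Φ hK'
        (integralHodgeClassesPullbackHom (liftHom (fstHom Y (prodObj X X)) (sndHom Y (prodObj X X) ≫ fstHom X X)) gY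
          (integralHodgeClassesPushforward 0 gY (liftHom f (𝟙 X)) eX eYX hX hgX hYX hgYX (unitIntegralHodgeClass X)))
        (integralHodgeClassesPullbackHom (sndHom Y (prodObj X X)) c'
          (integralHodgeClassesPushforward c c' (diagHom X) eX eXX hl hgX hl' hgXX (integralHodgeClassesPullbackHom f c v)))) := by
  rw [integralHodgeClassesCorrComp_pushforward_diagHom_transposeGraphClass f eX eY eYX hX hgX hYX hgYX hN₃ hac hl hk₂ eYY eT₄ eA₄ hgY hgYY hgT₄ hM₄' hca hK₂'
      hm hm' h3₄ h3₄',
    integralHodgeClassesCorrComp_transposeGraphClass_pushforward_diagHom f eX eY eXX eYX eT₃ hX hgX hYX hgYX hgXX hgT₃ hN₃ hN₃' hac hK' hl hl' h3₃ h3₃' hk₂]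

end TransposeGraph

/-! ## §4 The projection formula as an identity of correspondences: `Γ_f ∘ (f, 1_X)_*(u) = Δ_*(f_*u)`, `Γ_f ∘ Δ_*(u) ∘ ᵗΓ_f = Δ_*(f_*u)` -/

section ProjectionFormula

variable {X Y : ComplexTorusCat} {gX gY gXY gYX gYY gT₅ : ℕ} (f : X ⟶ Y) (eX : Fin (2 * gX) ≃ X.toIsog.ι) (eY : Fin (2 * gY) ≃ Y.toIsog.ι)
  (eXY : Fin (2 * gXY) ≃ (prodObj X Y).toIsog.ι) (eYX : Fin (2 * gYX) ≃ (prodObj Y X).toIsog.ι) (eYY : Fin (2 * gYY) ≃ (prodObj Y Y).toIsog.ι)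
  (eT₅ : Fin (2 * gT₅) ≃ (prodObj Y (prodObj X Y)).toIsog.ι) (hX : 2 * gX + 2 * 0 = 2 * gX) (hgX : gX + gX = 2 * gX) (hXY : 2 * gX + 2 * gY = 2 * gXY)
  (hgXY : gXY + gXY = 2 * gXY) (hgY : gY + gY = 2 * gY) (hgYX : gYX + gYX = 2 * gYX) (hgYY : gYY + gYY = 2 * gYY) (hgT₅ : gT₅ + gT₅ = 2 * gT₅)
  (hYX0 : 2 * gYX + 2 * 0 = 2 * gYX) (hT₅ : 2 * gYX + 2 * gY = 2 * gT₅) (hgg₅ : gYX + gY = gT₅)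
  {c c₁ ac K₅ b₅ l : ℕ} (hK₅ : ac + gY = K₅) (hl : l + 2 * c = 2 * gX) (hl₁ : l + 2 * c₁ = 2 * gY) (hk₂ : l + 2 * ac = 2 * gYX) (h3₅ : l + 2 * K₅ = 2 * gT₅)
  (hb₅ : l + 2 * b₅ = 2 * gYY)

include hYX0 hT₅ hgg₅ in
/-- **`Γ_f ∘ (f, 1_X)_*(u) = Δ_*(f_*u)`** for `f : X ⟶ Y` and `u ∈ Hdgᶜ(X, ℤ)`: `p₁₃_*(p₁₂^*((f, 1_X)_*u) · p₂₃^*[Γ_f]) = Δ_{Y*}(f_*u)` in `Hdg^{c+2g_Y−g_X}(Y × Y, ℤ)`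
(composite on `Y × (X × Y)`): Prop. 16.1.1 (c)(i) `Γ_f ∘ α = (1_Y × f)_*α` (g27) at `α = (f, 1_X)_*u`, then `(1_Y × f)_*(f, 1)_* = ((f, 1) ≫ (1 × f))_* = (f ≫ Δ_Y)_* =
Δ_{Y*} f_*` (§0, functoriality). [cite: Fulton1998, §16.1 Prop. 16.1.1 (c)(i) with proof (p0293 L24; p0294 L21–L28) and §1.4 (p0023 L1)]
[cite: Lange2023AbelianVarietiesComplex, §6.2.2 (p0304 L28)] -/
theorem integralHodgeClassesCorrComp_pushforward_liftHom_id_graphClass (u : integralHodgeClasses X.toIsog.Φ c) :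
    integralHodgeClassesPushforward K₅ b₅ (liftHom (fstHom Y (prodObj X Y)) (sndHom Y (prodObj X Y) ≫ sndHom X Y)) eT₅ eYY h3₅ hgT₅ hb₅ hgYY
      (integralHodgeClassesCup (prodObj Y (prodObj X Y)).toIsog.Φ hK₅
        (integralHodgeClassesPullbackHom (liftHom (fstHom Y (prodObj X Y)) (sndHom Y (prodObj X Y) ≫ fstHom X Y)) ac
          (integralHodgeClassesPushforward c ac (liftHom f (𝟙 X)) eX eYX hl hgX hk₂ hgYX u))
        (integralHodgeClassesPullbackHom (sndHom Y (prodObj X Y)) gY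
          (integralHodgeClassesPushforward 0 gY (graphHom f) eX eXY hX hgX hXY hgXY (unitIntegralHodgeClass X)))) =
      integralHodgeClassesPushforward c₁ b₅ (diagHom Y) eY eYY hl₁ hgY hb₅ hgYY
        (integralHodgeClassesPushforward c c₁ f eX eY hl hgX hl₁ hgY u) := by
  rw [integralHodgeClassesCorrComp_graphClass_right hgg₅ f eX eY eYX eXY eYY eT₅ hX hgX hXY hgXY hYX0 hgYX hT₅ hgT₅ hgYY hK₅ hk₂ h3₅ hb₅
      (integralHodgeClassesPushforward c ac (liftHom f (𝟙 X)) eX eYX hl hgX hk₂ hgYX u),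
    ← integralHodgeClassesPushforward_comp, liftHom_id_comp_prodMap_id,
    integralHodgeClassesPushforward_comp c c₁ f eX eY hl hgX hl₁ hgY b₅ (diagHom Y) eYY hb₅ hgYY]

variable {gXX gT₃ : ℕ} (eXX : Fin (2 * gXX) ≃ (prodObj X X).toIsog.ι) (eT₃ : Fin (2 * gT₃) ≃ (prodObj Y (prodObj X X)).toIsog.ι) (hYX : 2 * gX + 2 * gY = 2 * gYX)
  (hgXX : gXX + gXX = 2 * gXX) (hgT₃ : gT₃ + gT₃ = 2 * gT₃) (hN₃ : 2 * gY + 2 * gX = 2 * gYX) (hN₃' : 2 * gY + 2 * gXX = 2 * gT₃)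
  {c' K l₃ : ℕ} (hac : gY + c = ac) (hK' : gY + c' = K) (hl' : l + 2 * c' = 2 * gXX) (h3₃ : l₃ + 2 * K = 2 * gT₃) (h3₃' : l₃ + 2 * ac = 2 * gYX)

include hYX0 hT₅ hgg₅ hN₃ hN₃' hac hk₂ in
/-- **`Γ_f ∘ Δ_*(u) ∘ ᵗΓ_f = Δ_*(f_*u)` — THE PROJECTION FORMULA AS AN IDENTITY OF CORRESPONDENCES** for `f : X ⟶ Y` and `u ∈ Hdgᶜ(X, ℤ)`: the composite
`Γ_f ∘ (Δ_*(u) ∘ ᵗΓ_f)` (inner composite on `Y × (X × X)`, outer on `Y × (X × Y)`) is the multiplication correspondence of `f_*u ∈ Hdg^{c+g_Y−g_X}(Y, ℤ)`. Through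
`(Γ_f)_* = f_*`, `(ᵗΓ_f)_* = f^*`, `(Δ_*u)_* = u · (−)` (g27-#4, g27-#6, g33-#3 §2) and `(β ∘ α)_* = β_* ∘ α_*` (g27-#8) it acts by `b ↦ f_*(u · f^*b) = f_*u · b`, Fulton's
projection formula `f_*(x · f^*y) = f_*(x) · y`; as cycles it is Lieberman's `(f × f)_*α = Γ_f ∘ α ∘ ᵗΓ_f` (g33-#2) at `α = Δ_*(u)`, with `(f × f)_*Δ_*(u) = Δ_*(f_*u)`
because `Δ_X ≫ (f × f) = f ≫ Δ_Y`. Proof: §3 (`Δ_*(u) ∘ ᵗΓ_f = (f, 1_X)_*u`) and `Γ_f ∘ (f, 1_X)_*u = Δ_*(f_*u)`. [cite: Fulton1998, Prop. 8.3 (c) (p0132 L46–L48), §16.1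
Prop. 16.1.1 (c) (p0293 L24–L25), Prop. 16.1.2 (p0295 L19–L27) and Example 16.1.14 (ii) (p0302 L14–L20)] [cite: HuTruong2021, Lemma 2.12]
[cite: Lange2023AbelianVarietiesComplex, §6.2.1 Thm. 6.2.4 (p0302 L17–L19)] -/
theorem integralHodgeClassesCorrComp_corrComp_transposeGraphClass_pushforward_diagHom_graphClass (u : integralHodgeClasses X.toIsog.Φ c) :
    integralHodgeClassesPushforward K₅ b₅ (liftHom (fstHom Y (prodObj X Y)) (sndHom Y (prodObj X Y) ≫ sndHom X Y)) eT₅ eYY h3₅ hgT₅ hb₅ hgYY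
      (integralHodgeClassesCup (prodObj Y (prodObj X Y)).toIsog.Φ hK₅
        (integralHodgeClassesPullbackHom (liftHom (fstHom Y (prodObj X Y)) (sndHom Y (prodObj X Y) ≫ fstHom X Y)) ac
          (integralHodgeClassesPushforward K ac (liftHom (fstHom Y (prodObj X X)) (sndHom Y (prodObj X X) ≫ sndHom X X)) eT₃ eYX h3₃ hgT₃ h3₃' hgYX
            (integralHodgeClassesCup (prodObj Y (prodObj X X)).toIsog.Φ hK'
              (integralHodgeClassesPullbackHom (liftHom (fstHom Y (prodObj X X)) (sndHom Y (prodObj X X) ≫ fstHom X X)) gY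
                (integralHodgeClassesPushforward 0 gY (liftHom f (𝟙 X)) eX eYX hX hgX hYX hgYX (unitIntegralHodgeClass X)))
              (integralHodgeClassesPullbackHom (sndHom Y (prodObj X X)) c' (integralHodgeClassesPushforward c c' (diagHom X) eX eXX hl hgX hl' hgXX u)))))
        (integralHodgeClassesPullbackHom (sndHom Y (prodObj X Y)) gY
          (integralHodgeClassesPushforward 0 gY (graphHom f) eX eXY hX hgX hXY hgXY (unitIntegralHodgeClass X)))) =
      integralHodgeClassesPushforward c₁ b₅ (diagHom Y) eY eYY hl₁ hgY hb₅ hgYY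
        (integralHodgeClassesPushforward c c₁ f eX eY hl hgX hl₁ hgY u) := by
  rw [integralHodgeClassesCorrComp_transposeGraphClass_pushforward_diagHom f eX eY eXX eYX eT₃ hX hgX hYX hgYX hgXX hgT₃ hN₃ hN₃' hac hK' hl hl' h3₃ h3₃' hk₂,
    integralHodgeClassesCorrComp_pushforward_liftHom_id_graphClass f eX eY eXY eYX eYY eT₅ hX hgX hXY hgXY hgY hgYX hgYY hgT₅ hYX0 hT₅ hgg₅ hK₅ hl hl₁ hk₂ h3₅ hb₅]

end ProjectionFormula

end ComplexTorusCat

end Literature.AlgebraicGeometry.HodgeTheory
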